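import Mathlib.Analysis.Calculus.LocalExtr.Rolle
import Mathlib.Analysis.Calculus.Deriv.Mul
import Mathlib.Analysis.Calculus.Deriv.Add
import Mathlib.Tactic.Ring
import Mathlib.Tactic.Linarith
import Mathlib.Tactic.Positivity
import Mathlib.Tactic.LinearCombination
import HarnessLib

/-!
# Conjecture N (hodge-weil ladder, GAPS G51b), format (5,3): THE FOUR-BELOW-FOUR LEMMA (a Rolle count for moment-matched configurations)

Prover 2, generation 18 (note `run/shared/lean/b2b/hodge-weil/b2b-hweil-pv2-g18/MOMENTS-G18.md`). THE MOMENT PICTURE: on the pure locus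
(centring + P4) of a real (5,3) configuration the five E-charges `u₁..u₅` and the five numbers `v₁, v₂, v₃, ρ, −ρ` (`ρ² = S/2`,
`S = Σu² − Σv²`) have THE SAME FIRST THREE POWER SUMS (`p₁` = centring, `p₂` = definition of `S`, `p₃` = P4); equivalently
(`WeilClassTestFormatFiveThreeLineQuintic.lineId`) `∏_e(t − u_e)` and `∏(t − r)` differ by an affine function of `t`.
THIS FILE: two real 5-point configurations `x`, `r` with `p₁(x) = p₁(r)`, `p₂(x) = p₂(r)`, `p₃(x) = p₃(r)` can NOT have four of the
`x`'s strictly below four of the `r`'s (`four_below_four`: `x₁ ≤ x₂ ≤ x₃ ≤ x₄ < r₂, r₃, r₄, r₅`, `x₅` and `r₁` arbitrary), nor — by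
`t ↦ −t` — four of the `x`'s strictly above four of the `r`'s (`four_above_four`). PROOF: `f = ∏(t − x_a)` and `P = ∏(t − r_k)` have the
same second derivative `2·Z` (`Zx_eq_Z`); by Rolle's theorem (Mathlib `exists_hasDerivAt_eq_zero`, applied to `f` and to `f'`, with the
tie cases `x_a = x_{a+1}` handled algebraically) `Z` has two zeros `η₁ < η₂ ≤ x₄` or a double zero `≤ x₄`; but with `s_k = r_k − t > 0`
(`k ≥ 2`) one has `Z(t) = (t − r₁)e₂(s) − e₃(s)` and `Z'(t)·(2/6)… = e₂(s) − (t − r₁)e₁(s)`, and `e₃/e₂` is increasing in each `s_k`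
(Newton: `e₂² > e₁e₃`), so `Z` is 'once nonnegative, then positive' below `min(r₂..r₅)` (`two_zeros_core`, `double_zero_core`: explicit
positive polynomials). USE (companion file `WeilClassTestFormatFiveThreePattern044.lean`): in the charge pattern (0,4,4) with `Q₄ < 0`
the case `u₄ < −ρ` puts `u₁..u₄` below `−ρ, ρ, v₂, v₃`.
Pure real algebra + Rolle; nothing here is a case of HC, a rung or a door edge; no statement of Markman's papers is used. New cell result ⇒ Summits/.
-/

set_option linter.dupNamespace false

namespace Summit.HodgeConjecture.HodgeConjecture.WeilClassTestFourBelowFour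
/-- Derivative of a product of four monic linear factors. -/
theorem hasDerivAt_quartic (a b c d t : ℝ) :
    HasDerivAt (fun y : ℝ => (y - a) * (y - b) * (y - c) * (y - d))
      ((t - b) * (t - c) * (t - d) + (t - a) * (t - c) * (t - d) + (t - a) * (t - b) * (t - d) + (t - a) * (t - b) * (t - c)) t := by
  have ha : HasDerivAt (fun y : ℝ => y - a) 1 t := (hasDerivAt_id t).sub_const a
  have hb : HasDerivAt (fun y : ℝ => y - b) 1 t := (hasDerivAt_id t).sub_const b
  have hc : HasDerivAt (fun y : ℝ => y - c) 1 t := (hasDerivAt_id t).sub_const c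
  have hd : HasDerivAt (fun y : ℝ => y - d) 1 t := (hasDerivAt_id t).sub_const d
  exact (((ha.fun_mul hb).fun_mul hc).fun_mul hd).congr_deriv (by ring)

/-- Derivative of a product of five monic linear factors: `f' = Σ_a ∏_{b ≠ a}(t − x_b)`. -/
theorem hasDerivAt_quintic (x₁ x₂ x₃ x₄ x₅ t : ℝ) :
    HasDerivAt (fun y : ℝ => (y - x₁) * (y - x₂) * (y - x₃) * (y - x₄) * (y - x₅))
      ((t - x₂) * (t - x₃) * (t - x₄) * (t - x₅) + (t - x₁) * (t - x₃) * (t - x₄) * (t - x₅) + (t - x₁) * (t - x₂) * (t - x₄) * (t - x₅) + (t - x₁) * (t - x₂) * (t - x₃) * (t - x₅) + (t - x₁) * (t - x₂) * (t - x₃) * (t - x₄)) t := by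
  have h₁ : HasDerivAt (fun y : ℝ => y - x₁) 1 t := (hasDerivAt_id t).sub_const x₁
  have h₂ : HasDerivAt (fun y : ℝ => y - x₂) 1 t := (hasDerivAt_id t).sub_const x₂
  have h₃ : HasDerivAt (fun y : ℝ => y - x₃) 1 t := (hasDerivAt_id t).sub_const x₃
  have h₄ : HasDerivAt (fun y : ℝ => y - x₄) 1 t := (hasDerivAt_id t).sub_const x₄
  have h₅ : HasDerivAt (fun y : ℝ => y - x₅) 1 t := (hasDerivAt_id t).sub_const x₅
  exact ((((h₁.fun_mul h₂).fun_mul h₃).fun_mul h₄).fun_mul h₅).congr_deriv (by ring)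
/-- Second derivative: `(f')' = 2·Zx`, `Zx(t) = Σ_{a<b} ∏_{c ∉ {a,b}} (t − x_c)`. -/
theorem hasDerivAt_D1 (x₁ x₂ x₃ x₄ x₅ t : ℝ) :
    HasDerivAt (fun y : ℝ => (y - x₂) * (y - x₃) * (y - x₄) * (y - x₅) + (y - x₁) * (y - x₃) * (y - x₄) * (y - x₅) + (y - x₁) * (y - x₂) * (y - x₄) * (y - x₅) + (y - x₁) * (y - x₂) * (y - x₃) * (y - x₅) + (y - x₁) * (y - x₂) * (y - x₃) * (y - x₄))
      (2 * ((t - x₃) * (t - x₄) * (t - x₅) + (t - x₂) * (t - x₄) * (t - x₅) + (t - x₂) * (t - x₃) * (t - x₅) + (t - x₂) * (t - x₃) * (t - x₄) + (t - x₁) * (t - x₄) * (t - x₅) + (t - x₁) * (t - x₃) * (t - x₅) + (t - x₁) * (t - x₃) * (t - x₄) + (t - x₁) * (t - x₂) * (t - x₅) + (t - x₁) * (t - x₂) * (t - x₄) + (t - x₁) * (t - x₂) * (t - x₃))) t := by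
  have g1 := hasDerivAt_quartic x₂ x₃ x₄ x₅ t
  have g2 := hasDerivAt_quartic x₁ x₃ x₄ x₅ t
  have g3 := hasDerivAt_quartic x₁ x₂ x₄ x₅ t
  have g4 := hasDerivAt_quartic x₁ x₂ x₃ x₅ t
  have g5 := hasDerivAt_quartic x₁ x₂ x₃ x₄ t
  exact ((((g1.fun_add g2).fun_add g3).fun_add g4).fun_add g5).congr_deriv (by ring)

/-- Rolle for `f = ∏(t − x_a)`: between two zeros of `f` lies a zero of `f'`. -/
theorem rolle_f (x₁ x₂ x₃ x₄ x₅ a b : ℝ) (hab : a < b)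
    (ha : (a - x₁) * (a - x₂) * (a - x₃) * (a - x₄) * (a - x₅) = 0) (hb : (b - x₁) * (b - x₂) * (b - x₃) * (b - x₄) * (b - x₅) = 0) :
    ∃ ξ ∈ Set.Ioo a b, (ξ - x₂) * (ξ - x₃) * (ξ - x₄) * (ξ - x₅) + (ξ - x₁) * (ξ - x₃) * (ξ - x₄) * (ξ - x₅) + (ξ - x₁) * (ξ - x₂) * (ξ - x₄) * (ξ - x₅) + (ξ - x₁) * (ξ - x₂) * (ξ - x₃) * (ξ - x₅) + (ξ - x₁) * (ξ - x₂) * (ξ - x₃) * (ξ - x₄) = 0 := by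
  have hfI : (fun y : ℝ => (y - x₁) * (y - x₂) * (y - x₃) * (y - x₄) * (y - x₅)) a = (fun y : ℝ => (y - x₁) * (y - x₂) * (y - x₃) * (y - x₄) * (y - x₅)) b := by simp only []; rw [ha, hb]
  have hfc : ContinuousOn (fun y : ℝ => (y - x₁) * (y - x₂) * (y - x₃) * (y - x₄) * (y - x₅)) (Set.Icc a b) :=
    fun y _ => (hasDerivAt_quintic x₁ x₂ x₃ x₄ x₅ y).continuousAt.continuousWithinAt
  exact exists_hasDerivAt_eq_zero (f' := fun s : ℝ => (s - x₂) * (s - x₃) * (s - x₄) * (s - x₅) + (s - x₁) * (s - x₃) * (s - x₄) * (s - x₅) + (s - x₁) * (s - x₂) * (s - x₄) * (s - x₅) + (s - x₁) * (s - x₂) * (s - x₃) * (s - x₅) + (s - x₁) * (s - x₂) * (s - x₃) * (s - x₄)) hab hfc hfI (fun y _ => hasDerivAt_quintic x₁ x₂ x₃ x₄ x₅ y)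

/-- Rolle for `f'`: between two zeros of `f'` lies a zero of `Zx = f''/2`. -/
theorem rolle_D1 (x₁ x₂ x₃ x₄ x₅ a b : ℝ) (hab : a < b)
    (ha : (a - x₂) * (a - x₃) * (a - x₄) * (a - x₅) + (a - x₁) * (a - x₃) * (a - x₄) * (a - x₅) + (a - x₁) * (a - x₂) * (a - x₄) * (a - x₅) + (a - x₁) * (a - x₂) * (a - x₃) * (a - x₅) + (a - x₁) * (a - x₂) * (a - x₃) * (a - x₄) = 0) (hb : (b - x₂) * (b - x₃) * (b - x₄) * (b - x₅) + (b - x₁) * (b - x₃) * (b - x₄) * (b - x₅) + (b - x₁) * (b - x₂) * (b - x₄) * (b - x₅) + (b - x₁) * (b - x₂) * (b - x₃) * (b - x₅) + (b - x₁) * (b - x₂) * (b - x₃) * (b - x₄) = 0) :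
    ∃ η ∈ Set.Ioo a b, (η - x₃) * (η - x₄) * (η - x₅) + (η - x₂) * (η - x₄) * (η - x₅) + (η - x₂) * (η - x₃) * (η - x₅) + (η - x₂) * (η - x₃) * (η - x₄) + (η - x₁) * (η - x₄) * (η - x₅) + (η - x₁) * (η - x₃) * (η - x₅) + (η - x₁) * (η - x₃) * (η - x₄) + (η - x₁) * (η - x₂) * (η - x₅) + (η - x₁) * (η - x₂) * (η - x₄) + (η - x₁) * (η - x₂) * (η - x₃) = 0 := by
  have hfI : (fun y : ℝ => (y - x₂) * (y - x₃) * (y - x₄) * (y - x₅) + (y - x₁) * (y - x₃) * (y - x₄) * (y - x₅) + (y - x₁) * (y - x₂) * (y - x₄) * (y - x₅) + (y - x₁) * (y - x₂) * (y - x₃) * (y - x₅) + (y - x₁) * (y - x₂) * (y - x₃) * (y - x₄)) a = (fun y : ℝ => (y - x₂) * (y - x₃) * (y - x₄) * (y - x₅) + (y - x₁) * (y - x₃) * (y - x₄) * (y - x₅) + (y - x₁) * (y - x₂) * (y - x₄) * (y - x₅) + (y - x₁) * (y - x₂) * (y - x₃) * (y - x₅) + (y - x₁) * (y - x₂) * (y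 - x₃) * (y - x₄)) b := by simp only []; rw [ha, hb]
  have hfc : ContinuousOn (fun y : ℝ => (y - x₂) * (y - x₃) * (y - x₄) * (y - x₅) + (y - x₁) * (y - x₃) * (y - x₄) * (y - x₅) + (y - x₁) * (y - x₂) * (y - x₄) * (y - x₅) + (y - x₁) * (y - x₂) * (y - x₃) * (y - x₅) + (y - x₁) * (y - x₂) * (y - x₃) * (y - x₄)) (Set.Icc a b) :=
    fun y _ => (hasDerivAt_D1 x₁ x₂ x₃ x₄ x₅ y).continuousAt.continuousWithinAt
  obtain ⟨η, hη, h⟩ := exists_hasDerivAt_eq_zero (f' := fun s : ℝ => 2 * ((s - x₃) * (s - x₄) * (s - x₅) + (s - x₂) * (s - x₄) * (s - x₅) + (s - x₂) * (s - x₃) * (s - x₅) + (s - x₂) * (s - x₃) * (s - x₄) + (s - x₁) * (s - x₄) * (s - x₅) + (s - x₁) * (s - x₃) * (s - x₅) + (s - x₁) * (s - x₃) * (s - x₄) + (s - x₁) * (s - x₂) * (s - x₅) + (s - x₁) * (s - x₂) * (s - x₄) + (s - x₁) * (s - x₂) * (s - x₃))) hab hfc hfI (fun y _ => hasDerivAt_D1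 x₁ x₂ x₃ x₄ x₅ y)
  exact ⟨η, hη, by linarith⟩

/-- CORE INEQUALITY (two zeros). With `s_k > 0` (`k = 2..5`), `δ > 0` and any `c`: the equations `c·e₂(s) = e₃(s)` (`Z(η₂) = 0`,
`c = η₂ − r₁`, `s_k = r_k − η₂`) and `(c − δ)·e₂(s + δ) = e₃(s + δ)` (`Z(η₁) = 0`, `η₁ = η₂ − δ`) are incompatible:
`e₃(s+δ)e₂(s) − e₃(s)e₂(s+δ) + δe₂(s)e₂(s+δ)` is a polynomial with positive coefficients. -/
theorem two_zeros_core (s₂ s₃ s₄ s₅ δ c : ℝ) (hs₂ : 0 < s₂) (hs₃ : 0 < s₃) (hs₄ : 0 < s₄) (hs₅ : 0 < s₅) (hδ : 0 < δ)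
    (hZ₂ : c * (s₂ * s₃ + s₂ * s₄ + s₂ * s₅ + s₃ * s₄ + s₃ * s₅ + s₄ * s₅) - (s₂ * s₃ * s₄ + s₂ * s₃ * s₅ + s₂ * s₄ * s₅ + s₃ * s₄ * s₅) = 0)
    (hZ₁ : (c - δ) * ((s₂ + δ) * (s₃ + δ) + (s₂ + δ) * (s₄ + δ) + (s₂ + δ) * (s₅ + δ) + (s₃ + δ) * (s₄ + δ) + (s₃ + δ) * (s₅ + δ) + (s₄ + δ) * (s₅ + δ)) - ((s₂ + δ) * (s₃ + δ) * (s₄ + δ) + (s₂ + δ) * (s₃ + δ) * (s₅ + δ) + (s₂ + δ) * (s₄ + δ) * (s₅ + δ) + (s₃ + δ) * (s₄ + δ) * (s₅ + δ)) = 0) : False := by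
  have key : (c - δ) * ((s₂ + δ) * (s₃ + δ) + (s₂ + δ) * (s₄ + δ) + (s₂ + δ) * (s₅ + δ) + (s₃ + δ) * (s₄ + δ) + (s₃ + δ) * (s₅ + δ) + (s₄ + δ) * (s₅ + δ)) - ((s₂ + δ) * (s₃ + δ) * (s₄ + δ) + (s₂ + δ) * (s₃ + δ) * (s₅ + δ) + (s₂ + δ) * (s₄ + δ) * (s₅ + δ) + (s₃ + δ) * (s₄ + δ) * (s₅ + δ)) = 0 - 0 := by rw [hZ₁]; ring
  have pos : 0 < 3 * s₂ ^ 2 * s₃ ^ 2 * δ + 3 * s₂ ^ 2 * s₃ * s₄ * δ + 3 * s₂ ^ 2 * s₃ * s₅ * δ + 6 * s₂ ^ 2 * s₃ * δ ^ 2 + 3 * s₂ ^ 2 * s₄ ^ 2 * δ + 3 * s₂ ^ 2 * s₄ * s₅ * δ + 6 * s₂ ^ 2 * s₄ * δ ^ 2 + 3 * s₂ ^ 2 * s₅ ^ 2 * δ + 6 * s₂ ^ 2 * s₅ * δ ^ 2 + 3 * s₂ * s₃ ^ 2 * s₄ * δ + 3 * s₂ * s₃ ^ 2 * s₅ * δ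 + 6 * s₂ * s₃ ^ 2 * δ ^ 2 + 3 * s₂ * s₃ * s₄ ^ 2 * δ + 6 * s₂ * s₃ * s₄ * s₅ * δ + 12 * s₂ * s₃ * s₄ * δ ^ 2 + 3 * s₂ * s₃ * s₅ ^ 2 * δ + 12 * s₂ * s₃ * s₅ * δ ^ 2 + 10 * s₂ * s₃ * δ ^ 3 + 3 * s₂ * s₄ ^ 2 * s₅ * δ + 6 * s₂ * s₄ ^ 2 * δ ^ 2 + 3 * s₂ * s₄ * s₅ ^ 2 * δ + 12 * s₂ * s₄ * s₅ * δ ^ 2 + 10 * s₂ * s₄ * δ ^ 3 + 6 * s₂ * s₅ ^ 2 * δ ^ 2 + 10 * s₂ * s₅ * δ ^ 3 + 3 * s₃ ^ 2 * s₄ ^ 2 * δ + 3 * s₃ ^ 2 * s₄ * s₅ * δ + 6 * s₃ ^ 2 * s₄ * δ ^ 2 + 3 * s₃ ^ 2 * s₅ ^ 2 * δ + 6 * s₃ ^ 2 * s₅ * δ ^ 2 + 3 * s₃ * s₄ ^ 2 * s₅ * δ + 6 * s₃ * s₄ ^ 2 * δ ^ 2 + 3 * s₃ * s₄ * s₅ ^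 2 * δ + 12 * s₃ * s₄ * s₅ * δ ^ 2 + 10 * s₃ * s₄ * δ ^ 3 + 6 * s₃ * s₅ ^ 2 * δ ^ 2 + 10 * s₃ * s₅ * δ ^ 3 + 3 * s₄ ^ 2 * s₅ ^ 2 * δ + 6 * s₄ ^ 2 * s₅ * δ ^ 2 + 6 * s₄ * s₅ ^ 2 * δ ^ 2 + 10 * s₄ * s₅ * δ ^ 3 := by positivity
  have e : ((c - δ) * ((s₂ + δ) * (s₃ + δ) + (s₂ + δ) * (s₄ + δ) + (s₂ + δ) * (s₅ + δ) + (s₃ + δ) * (s₄ + δ) + (s₃ + δ) * (s₅ + δ) + (s₄ + δ) * (s₅ + δ)) - ((s₂ + δ) * (s₃ + δ) * (s₄ + δ) + (s₂ + δ) * (s₃ + δ) * (s₅ + δ) + (s₂ + δ) * (s₄ + δ) * (s₅ + δ) + (s₃ + δ) * (s₄ + δ) * (s₅ + δ))) * (s₂ * s₃ + s₂ * s₄ + s₂ * s₅ + s₃ * s₄ + s₃ * s₅ + s₄ * s₅) - (c * (s₂ * s₃ + s₂ * s₄ + s₂ * s₅ + s₃ * s₄ + s₃ * s₅ + s₄ *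 s₅) - (s₂ * s₃ * s₄ + s₂ * s₃ * s₅ + s₂ * s₄ * s₅ + s₃ * s₄ * s₅)) * ((s₂ + δ) * (s₃ + δ) + (s₂ + δ) * (s₄ + δ) + (s₂ + δ) * (s₅ + δ) + (s₃ + δ) * (s₄ + δ) + (s₃ + δ) * (s₅ + δ) + (s₄ + δ) * (s₅ + δ)) = -(3 * s₂ ^ 2 * s₃ ^ 2 * δ + 3 * s₂ ^ 2 * s₃ * s₄ * δ + 3 * s₂ ^ 2 * s₃ * s₅ * δ + 6 * s₂ ^ 2 * s₃ * δ ^ 2 + 3 * s₂ ^ 2 * s₄ ^ 2 * δ + 3 * s₂ ^ 2 * s₄ * s₅ * δ + 6 * s₂ ^ 2 * s₄ * δ ^ 2 + 3 * s₂ ^ 2 * s₅ ^ 2 * δ + 6 * s₂ ^ 2 * s₅ * δ ^ 2 + 3 * s₂ * s₃ ^ 2 * s₄ * δ + 3 * s₂ * s₃ ^ 2 * s₅ * δ + 6 * s₂ * s₃ ^ 2 * δ ^ 2 + 3 * s₂ * s₃ * s₄ ^ 2 * δ + 6 * s₂ * s₃ * s₄ * s₅ * δ + 12 * s₂ * s₃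 * s₄ * δ ^ 2 + 3 * s₂ * s₃ * s₅ ^ 2 * δ + 12 * s₂ * s₃ * s₅ * δ ^ 2 + 10 * s₂ * s₃ * δ ^ 3 + 3 * s₂ * s₄ ^ 2 * s₅ * δ + 6 * s₂ * s₄ ^ 2 * δ ^ 2 + 3 * s₂ * s₄ * s₅ ^ 2 * δ + 12 * s₂ * s₄ * s₅ * δ ^ 2 + 10 * s₂ * s₄ * δ ^ 3 + 6 * s₂ * s₅ ^ 2 * δ ^ 2 + 10 * s₂ * s₅ * δ ^ 3 + 3 * s₃ ^ 2 * s₄ ^ 2 * δ + 3 * s₃ ^ 2 * s₄ * s₅ * δ + 6 * s₃ ^ 2 * s₄ * δ ^ 2 + 3 * s₃ ^ 2 * s₅ ^ 2 * δ + 6 * s₃ ^ 2 * s₅ * δ ^ 2 + 3 * s₃ * s₄ ^ 2 * s₅ * δ + 6 * s₃ * s₄ ^ 2 * δ ^ 2 + 3 * s₃ * s₄ * s₅ ^ 2 * δ + 12 * s₃ * s₄ * s₅ * δ ^ 2 + 10 * s₃ * s₄ * δ ^ 3 + 6 * s₃ * s₅ ^ 2 * δ ^ 2 + 10 * s₃ *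 s₅ * δ ^ 3 + 3 * s₄ ^ 2 * s₅ ^ 2 * δ + 6 * s₄ ^ 2 * s₅ * δ ^ 2 + 6 * s₄ * s₅ ^ 2 * δ ^ 2 + 10 * s₄ * s₅ * δ ^ 3) := by ring
  rw [hZ₁, hZ₂] at e
  linarith

/-- CORE INEQUALITY (double zero). With `s_k > 0`: `c·e₂(s) = e₃(s)` (`Z(η) = 0`) and `e₂(s) = c·e₁(s)` (`Z'(η) = 0`) are
incompatible, because `e₂² − e₁e₃ > 0` (Newton; a polynomial with positive coefficients). -/
theorem double_zero_core (s₂ s₃ s₄ s₅ c : ℝ) (hs₂ : 0 < s₂) (hs₃ : 0 < s₃) (hs₄ : 0 < s₄) (hs₅ : 0 < s₅)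
    (hZ : c * (s₂ * s₃ + s₂ * s₄ + s₂ * s₅ + s₃ * s₄ + s₃ * s₅ + s₄ * s₅) - (s₂ * s₃ * s₄ + s₂ * s₃ * s₅ + s₂ * s₄ * s₅ + s₃ * s₄ * s₅) = 0)
    (hW : (s₂ * s₃ + s₂ * s₄ + s₂ * s₅ + s₃ * s₄ + s₃ * s₅ + s₄ * s₅) - c * (s₂ + s₃ + s₄ + s₅) = 0) : False := by
  have pos : 0 < s₂ ^ 2 * s₃ ^ 2 + s₂ ^ 2 * s₃ * s₄ + s₂ ^ 2 * s₃ * s₅ + s₂ ^ 2 * s₄ ^ 2 + s₂ ^ 2 * s₄ * s₅ + s₂ ^ 2 * s₅ ^ 2 + s₂ * s₃ ^ 2 * s₄ + s₂ * s₃ ^ 2 * s₅ + s₂ * s₃ * s₄ ^ 2 + 2 * s₂ * s₃ * s₄ * s₅ + s₂ * s₃ * s₅ ^ 2 + s₂ * s₄ ^ 2 * s₅ + s₂ * s₄ * s₅ ^ 2 + s₃ ^ 2 * s₄ ^ 2 + s₃ ^ 2 * s₄ * s₅ + s₃ ^ 2 * s₅ ^ 2 + s₃ * s₄ ^ 2 *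 s₅ + s₃ * s₄ * s₅ ^ 2 + s₄ ^ 2 * s₅ ^ 2 := by positivity
  have e : (c * (s₂ * s₃ + s₂ * s₄ + s₂ * s₅ + s₃ * s₄ + s₃ * s₅ + s₄ * s₅) - (s₂ * s₃ * s₄ + s₂ * s₃ * s₅ + s₂ * s₄ * s₅ + s₃ * s₄ * s₅)) * (s₂ + s₃ + s₄ + s₅) + ((s₂ * s₃ + s₂ * s₄ + s₂ * s₅ + s₃ * s₄ + s₃ * s₅ + s₄ * s₅) - c * (s₂ + s₃ + s₄ + s₅)) * (s₂ * s₃ + s₂ * s₄ + s₂ * s₅ + s₃ * s₄ + s₃ * s₅ + s₄ * s₅) = s₂ ^ 2 * s₃ ^ 2 + s₂ ^ 2 * s₃ * s₄ + s₂ ^ 2 * s₃ * s₅ + s₂ ^ 2 * s₄ ^ 2 + s₂ ^ 2 * s₄ * s₅ + s₂ ^ 2 * s₅ ^ 2 + s₂ * s₃ ^ 2 * s₄ + s₂ * s₃ ^ 2 * s₅ + s₂ * s₃ * s₄ ^ 2 + 2 * s₂ * s₃ * s₄ * s₅ + s₂ * s₃ * s₅ ^ 2 + s₂ * s₄ ^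 2 * s₅ + s₂ * s₄ * s₅ ^ 2 + s₃ ^ 2 * s₄ ^ 2 + s₃ ^ 2 * s₄ * s₅ + s₃ ^ 2 * s₅ ^ 2 + s₃ * s₄ ^ 2 * s₅ + s₃ * s₄ * s₅ ^ 2 + s₄ ^ 2 * s₅ ^ 2 := by ring
  rw [hZ, hW] at e
  linarith

/-- `f'' = P''`: the pair sums `Zx(t) = Σ_{a<b}∏_{c∉{a,b}}(t − x_c)` and `Z(t)` (the same in the `r`'s) agree when `p₁, p₂, p₃` agree. -/
theorem Zx_eq_Z (x₁ x₂ x₃ x₄ x₅ r₁ r₂ r₃ r₄ r₅ t : ℝ)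
    (p1 : x₁ + x₂ + x₃ + x₄ + x₅ = r₁ + r₂ + r₃ + r₄ + r₅) (p2 : x₁ ^ 2 + x₂ ^ 2 + x₃ ^ 2 + x₄ ^ 2 + x₅ ^ 2 = r₁ ^ 2 + r₂ ^ 2 + r₃ ^ 2 + r₄ ^ 2 + r₅ ^ 2) (p3 : x₁ ^ 3 + x₂ ^ 3 + x₃ ^ 3 + x₄ ^ 3 + x₅ ^ 3 = r₁ ^ 3 + r₂ ^ 3 + r₃ ^ 3 + r₄ ^ 3 + r₅ ^ 3) :
    (t - x₃) * (t - x₄) * (t - x₅) + (t - x₂) * (t - x₄) * (t - x₅) + (t - x₂) * (t - x₃) * (t - x₅) + (t - x₂) * (t - x₃) * (t - x₄) + (t - x₁) * (t - x₄) * (t - x₅) + (t - x₁) * (t - x₃) * (t - x₅) + (t - x₁) * (t - x₃) * (t - x₄) + (t - x₁) * (t - x₂) * (t - x₅) + (t - x₁) * (t - x₂) * (t - x₄) + (t - x₁) * (t - x₂) * (t - x₃) = (t - r₃) * (t - r₄) * (t - r₅) + (t - r₂) * (t - r₄) * (t - r₅) + (t - r₂) * (t - r₃) * (t - r₅) + (t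 - r₂) * (t - r₃) * (t - r₄) + (t - r₁) * (t - r₄) * (t - r₅) + (t - r₁) * (t - r₃) * (t - r₅) + (t - r₁) * (t - r₃) * (t - r₄) + (t - r₁) * (t - r₂) * (t - r₅) + (t - r₁) * (t - r₂) * (t - r₄) + (t - r₁) * (t - r₂) * (t - r₃) := by
  linear_combination (-6 * t ^ 2 + (3 * t / 2) * ((x₁ + x₂ + x₃ + x₄ + x₅) + (r₁ + r₂ + r₃ + r₄ + r₅)) - (1 / 6) * ((x₁ + x₂ + x₃ + x₄ + x₅) ^ 2 + (x₁ + x₂ + x₃ + x₄ + x₅) * (r₁ + r₂ + r₃ + r₄ + r₅) + (r₁ + r₂ + r₃ + r₄ + r₅) ^ 2 - 3 * (x₁ ^ 2 + x₂ ^ 2 + x₃ ^ 2 + x₄ ^ 2 + x₅ ^ 2))) * p1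
    + (-(3 * t / 2) + (r₁ + r₂ + r₃ + r₄ + r₅) / 2) * p2 + (-1 / 3 : ℝ) * p3

/-- `f⁽³⁾ = P⁽³⁾`: the triple sums `Wx(t) = Σ_{a<b<c}∏_{d∉{a,b,c}}(t − x_d)` and `W(t)` agree when `p₁, p₂` agree. -/
theorem Wx_eq_W (x₁ x₂ x₃ x₄ x₅ r₁ r₂ r₃ r₄ r₅ t : ℝ)
    (p1 : x₁ + x₂ + x₃ + x₄ + x₅ = r₁ + r₂ + r₃ + r₄ + r₅) (p2 : x₁ ^ 2 + x₂ ^ 2 + x₃ ^ 2 + x₄ ^ 2 + x₅ ^ 2 = r₁ ^ 2 + r₂ ^ 2 + r₃ ^ 2 + r₄ ^ 2 + r₅ ^ 2) :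
    (t - x₄) * (t - x₅) + (t - x₃) * (t - x₅) + (t - x₃) * (t - x₄) + (t - x₂) * (t - x₅) + (t - x₂) * (t - x₄) + (t - x₂) * (t - x₃) + (t - x₁) * (t - x₅) + (t - x₁) * (t - x₄) + (t - x₁) * (t - x₃) + (t - x₁) * (t - x₂) = (t - r₄) * (t - r₅) + (t - r₃) * (t - r₅) + (t - r₃) * (t - r₄) + (t - r₂) * (t - r₅) + (t - r₂) * (t - r₄) + (t - r₂) * (t - r₃) + (t - r₁) * (t - r₅) + (t - r₁) * (t - r₄) + (t - r₁) * (t - r₃) + (t - r₁) * (t - r₂) := by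
  linear_combination (-4 * t + ((x₁ + x₂ + x₃ + x₄ + x₅) + (r₁ + r₂ + r₃ + r₄ + r₅)) / 2) * p1 + (-1 / 2 : ℝ) * p2

/-- TWO ZEROS OF `Z = P''/2` BELOW FOUR ROOTS ARE IMPOSSIBLE: `Z(η₁) = Z(η₂) = 0`, `η₁ < η₂ < r₂, r₃, r₄, r₅` is contradictory. -/
theorem two_zeros (r₁ r₂ r₃ r₄ r₅ η₁ η₂ : ℝ) (h : η₁ < η₂) (b₂ : η₂ < r₂) (b₃ : η₂ < r₃) (b₄ : η₂ < r₄) (b₅ : η₂ < r₅)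
    (hZ₁ : (η₁ - r₃) * (η₁ - r₄) * (η₁ - r₅) + (η₁ - r₂) * (η₁ - r₄) * (η₁ - r₅) + (η₁ - r₂) * (η₁ - r₃) * (η₁ - r₅) + (η₁ - r₂) * (η₁ - r₃) * (η₁ - r₄) + (η₁ - r₁) * (η₁ - r₄) * (η₁ - r₅) + (η₁ - r₁) * (η₁ - r₃) * (η₁ - r₅) + (η₁ - r₁) * (η₁ - r₃) * (η₁ - r₄) + (η₁ - r₁) * (η₁ - r₂) * (η₁ - r₅) + (η₁ - r₁) * (η₁ - r₂) * (η₁ - r₄) + (η₁ - r₁) * (η₁ - r₂) * (η₁ - r₃) = 0) (hZ₂ : (η₂ - r₃) * (η₂ - r₄) * (η₂ - r₅) + (η₂ - r₂) * (η₂ - r₄) * (η₂ - r₅) + (η₂ - r₂) * (η₂ - r₃) * (η₂ - r₅) + (η₂ - r₂) * (η₂ - r₃) * (η₂ - r₄) + (η₂ - r₁) * (η₂ - r₄) * (η₂ - r₅) + (η₂ - r₁) * (η₂ - r₃) * (η₂ - r₅) + (η₂ - r₁) * (η₂ - r₃) * (η₂ - r₄) + (η₂ - r₁) * (η₂ - r₂)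 * (η₂ - r₅) + (η₂ - r₁) * (η₂ - r₂) * (η₂ - r₄) + (η₂ - r₁) * (η₂ - r₂) * (η₂ - r₃) = 0) : False := by
  refine two_zeros_core (r₂ - η₂) (r₃ - η₂) (r₄ - η₂) (r₅ - η₂) (η₂ - η₁) (η₂ - r₁)
    (by linarith) (by linarith) (by linarith) (by linarith) (by linarith) ?_ ?_
  · linear_combination hZ₂
  · linear_combination hZ₁

/-- A DOUBLE ZERO OF `Z` BELOW FOUR ROOTS IS IMPOSSIBLE: `Z(η) = 0 = W(η)` (`W = P⁽³⁾/6`), `η < r₂, r₃, r₄, r₅` is contradictory. -/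
theorem double_zero (r₁ r₂ r₃ r₄ r₅ η : ℝ) (b₂ : η < r₂) (b₃ : η < r₃) (b₄ : η < r₄) (b₅ : η < r₅)
    (hZ : (η - r₃) * (η - r₄) * (η - r₅) + (η - r₂) * (η - r₄) * (η - r₅) + (η - r₂) * (η - r₃) * (η - r₅) + (η - r₂) * (η - r₃) * (η - r₄) + (η - r₁) * (η - r₄) * (η - r₅) + (η - r₁) * (η - r₃) * (η - r₅) + (η - r₁) * (η - r₃) * (η - r₄) + (η - r₁) * (η - r₂) * (η - r₅) + (η - r₁) * (η - r₂) * (η - r₄) + (η - r₁) * (η - r₂) * (η - r₃) = 0) (hW : (η - r₄) * (η - r₅) + (η - r₃) * (η - r₅) + (η - r₃) * (η - r₄) + (η - r₂) * (η - r₅) + (η - r₂) * (η - r₄) + (η - r₂) * (η - r₃) + (η - r₁) * (η - r₅) + (η - r₁) * (η - r₄) + (η - r₁) * (η - r₃) + (η - r₁) * (η - r₂) = 0) : False := by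
  refine double_zero_core (r₂ - η) (r₃ - η) (r₄ - η) (r₅ - η) (η - r₁)
    (by linarith) (by linarith) (by linarith) (by linarith) ?_ ?_
  · linear_combination hZ
  · linear_combination hW

/-- **FOUR-BELOW-FOUR LEMMA.** Two real 5-point configurations `x`, `r` with equal power sums `p₁, p₂, p₃` cannot have
`x₁ ≤ x₂ ≤ x₃ ≤ x₄ < r₂, r₃, r₄, r₅` (`x₅`, `r₁` unrestricted). (Rolle: `f = ∏(t − x_a)` has four roots `≤ x₄`, so `f'' = P''` has two
there; `two_zeros` / `double_zero`.) -/
theorem four_below_four (x₁ x₂ x₃ x₄ x₅ r₁ r₂ r₃ r₄ r₅ : ℝ)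
    (h₁₂ : x₁ ≤ x₂) (h₂₃ : x₂ ≤ x₃) (h₃₄ : x₃ ≤ x₄)
    (b₂ : x₄ < r₂) (b₃ : x₄ < r₃) (b₄ : x₄ < r₄) (b₅ : x₄ < r₅)
    (p1 : x₁ + x₂ + x₃ + x₄ + x₅ = r₁ + r₂ + r₃ + r₄ + r₅) (p2 : x₁ ^ 2 + x₂ ^ 2 + x₃ ^ 2 + x₄ ^ 2 + x₅ ^ 2 = r₁ ^ 2 + r₂ ^ 2 + r₃ ^ 2 + r₄ ^ 2 + r₅ ^ 2) (p3 : x₁ ^ 3 + x₂ ^ 3 + x₃ ^ 3 + x₄ ^ 3 + x₅ ^ 3 = r₁ ^ 3 + r₂ ^ 3 + r₃ ^ 3 + r₄ ^ 3 + r₅ ^ 3) : False := by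
  -- zeros of f at the four roots, and the algebraic tie facts
  have f₁ : (x₁ - x₁) * (x₁ - x₂) * (x₁ - x₃) * (x₁ - x₄) * (x₁ - x₅) = 0 := by ring
  have f₂ : (x₂ - x₁) * (x₂ - x₂) * (x₂ - x₃) * (x₂ - x₄) * (x₂ - x₅) = 0 := by ring
  have f₃ : (x₃ - x₁) * (x₃ - x₂) * (x₃ - x₃) * (x₃ - x₄) * (x₃ - x₅) = 0 := by ring
  have f₄ : (x₄ - x₁) * (x₄ - x₂) * (x₄ - x₃) * (x₄ - x₄) * (x₄ - x₅) = 0 := by ring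
  have ZZ : ∀ t, (t - x₃) * (t - x₄) * (t - x₅) + (t - x₂) * (t - x₄) * (t - x₅) + (t - x₂) * (t - x₃) * (t - x₅) + (t - x₂) * (t - x₃) * (t - x₄) + (t - x₁) * (t - x₄) * (t - x₅) + (t - x₁) * (t - x₃) * (t - x₅) + (t - x₁) * (t - x₃) * (t - x₄) + (t - x₁) * (t - x₂) * (t - x₅) + (t - x₁) * (t - x₂) * (t - x₄) + (t - x₁) * (t - x₂) * (t - x₃) = (t - r₃) * (t - r₄) * (t - r₅) + (t - r₂) * (t - r₄) * (t - r₅) + (t - r₂) * (t - r₃) * (t - r₅) + (t - r₂) * (t - r₃) * (t - r₄) + (t - r₁) * (t - r₄) * (t - r₅) + (t - r₁) * (t - r₃) * (t - r₅) + (t - r₁) * (t - r₃) * (t - r₄) + (t - r₁) * (t - r₂) * (t - r₅) + (t - r₁) * (t - r₂) * (t - r₄) + (t - r₁) * (t - r₂) * (t - r₃) := fun t => Zx_eq_Z x₁ x₂ x₃ x₄ x₅ r₁ r₂ r₃ r₄ r₅ t p1 p2 p3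
  -- conclude from two zeros η₁ < η₂ ≤ x₄ of Zx
  have fin2 : ∀ η₁ η₂, η₁ < η₂ → η₂ ≤ x₄ → (η₁ - x₃) * (η₁ - x₄) * (η₁ - x₅) + (η₁ - x₂) * (η₁ - x₄) * (η₁ - x₅) + (η₁ - x₂) * (η₁ - x₃) * (η₁ - x₅) + (η₁ - x₂) * (η₁ - x₃) * (η₁ - x₄) + (η₁ - x₁) * (η₁ - x₄) * (η₁ - x₅) + (η₁ - x₁) * (η₁ - x₃) * (η₁ - x₅) + (η₁ - x₁) * (η₁ - x₃) * (η₁ - x₄) + (η₁ - x₁) * (η₁ - x₂) * (η₁ - x₅) + (η₁ - x₁) * (η₁ - x₂) * (η₁ - x₄) + (η₁ - x₁) * (η₁ - x₂) * (η₁ - x₃) = 0 → (η₂ - x₃) * (η₂ - x₄) * (η₂ - x₅) + (η₂ - x₂) * (η₂ - x₄) * (η₂ - x₅) + (η₂ - x₂) * (η₂ - x₃) * (η₂ - x₅) + (η₂ - x₂) * (η₂ - x₃) * (η₂ - x₄) + (η₂ - x₁) * (η₂ - x₄) * (η₂ - x₅) + (η₂ - x₁) * (η₂ - x₃) * (η₂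 - x₅) + (η₂ - x₁) * (η₂ - x₃) * (η₂ - x₄) + (η₂ - x₁) * (η₂ - x₂) * (η₂ - x₅) + (η₂ - x₁) * (η₂ - x₂) * (η₂ - x₄) + (η₂ - x₁) * (η₂ - x₂) * (η₂ - x₃) = 0 → False := by
    intro η₁ η₂ hlt hle z1 z2
    rw [ZZ η₁] at z1; rw [ZZ η₂] at z2
    exact two_zeros r₁ r₂ r₃ r₄ r₅ η₁ η₂ hlt (by linarith) (by linarith) (by linarith) (by linarith) z1 z2
  rcases h₁₂.lt_or_eq with l₁₂ | e₁₂ <;> rcases h₂₃.lt_or_eq with l₂₃ | e₂₃ <;> rcases h₃₄.lt_or_eq with l₃₄ | e₃₄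
  · -- < < <
    obtain ⟨ξ₁, ⟨a₁, c₁⟩, d₁⟩ := rolle_f x₁ x₂ x₃ x₄ x₅ x₁ x₂ l₁₂ f₁ f₂
    obtain ⟨ξ₂, ⟨a₂, c₂⟩, d₂⟩ := rolle_f x₁ x₂ x₃ x₄ x₅ x₂ x₃ l₂₃ f₂ f₃
    obtain ⟨ξ₃, ⟨a₃, c₃⟩, d₃⟩ := rolle_f x₁ x₂ x₃ x₄ x₅ x₃ x₄ l₃₄ f₃ f₄
    obtain ⟨η₁, ⟨i₁, j₁⟩, z₁⟩ := rolle_D1 x₁ x₂ x₃ x₄ x₅ ξ₁ ξ₂ (by linarith) d₁ d₂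
    obtain ⟨η₂, ⟨i₂, j₂⟩, z₂⟩ := rolle_D1 x₁ x₂ x₃ x₄ x₅ ξ₂ ξ₃ (by linarith) d₂ d₃
    exact fin2 η₁ η₂ (by linarith) (by linarith) z₁ z₂
  · -- < < = : x₃ is a double root, f'(x₃) = 0
    have d₃ : (x₃ - x₂) * (x₃ - x₃) * (x₃ - x₄) * (x₃ - x₅) + (x₃ - x₁) * (x₃ - x₃) * (x₃ - x₄) * (x₃ - x₅) + (x₃ - x₁) * (x₃ - x₂) * (x₃ - x₄) * (x₃ - x₅) + (x₃ - x₁) * (x₃ - x₂) * (x₃ - x₃) * (x₃ - x₅) + (x₃ - x₁) * (x₃ - x₂) * (x₃ - x₃) * (x₃ - x₄) = 0 := by subst e₃₄; ring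
    obtain ⟨ξ₁, ⟨a₁, c₁⟩, d₁⟩ := rolle_f x₁ x₂ x₃ x₄ x₅ x₁ x₂ l₁₂ f₁ f₂
    obtain ⟨ξ₂, ⟨a₂, c₂⟩, d₂⟩ := rolle_f x₁ x₂ x₃ x₄ x₅ x₂ x₃ l₂₃ f₂ f₃
    obtain ⟨η₁, ⟨i₁, j₁⟩, z₁⟩ := rolle_D1 x₁ x₂ x₃ x₄ x₅ ξ₁ ξ₂ (by linarith) d₁ d₂
    obtain ⟨η₂, ⟨i₂, j₂⟩, z₂⟩ := rolle_D1 x₁ x₂ x₃ x₄ x₅ ξ₂ x₃ c₂ d₂ d₃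
    exact fin2 η₁ η₂ (by linarith) (by linarith) z₁ z₂
  · -- < = < : x₂ = x₃ is a double root
    have d₂ : (x₂ - x₂) * (x₂ - x₃) * (x₂ - x₄) * (x₂ - x₅) + (x₂ - x₁) * (x₂ - x₃) * (x₂ - x₄) * (x₂ - x₅) + (x₂ - x₁) * (x₂ - x₂) * (x₂ - x₄) * (x₂ - x₅) + (x₂ - x₁) * (x₂ - x₂) * (x₂ - x₃) * (x₂ - x₅) + (x₂ - x₁) * (x₂ - x₂) * (x₂ - x₃) * (x₂ - x₄) = 0 := by subst e₂₃; ring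
    have d₂' : (x₃ - x₂) * (x₃ - x₃) * (x₃ - x₄) * (x₃ - x₅) + (x₃ - x₁) * (x₃ - x₃) * (x₃ - x₄) * (x₃ - x₅) + (x₃ - x₁) * (x₃ - x₂) * (x₃ - x₄) * (x₃ - x₅) + (x₃ - x₁) * (x₃ - x₂) * (x₃ - x₃) * (x₃ - x₅) + (x₃ - x₁) * (x₃ - x₂) * (x₃ - x₃) * (x₃ - x₄) = 0 := by subst e₂₃; ring
    obtain ⟨ξ₁, ⟨a₁, c₁⟩, d₁⟩ := rolle_f x₁ x₂ x₃ x₄ x₅ x₁ x₂ l₁₂ f₁ f₂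
    obtain ⟨ξ₃, ⟨a₃, c₃⟩, d₃⟩ := rolle_f x₁ x₂ x₃ x₄ x₅ x₃ x₄ l₃₄ f₃ f₄
    obtain ⟨η₁, ⟨i₁, j₁⟩, z₁⟩ := rolle_D1 x₁ x₂ x₃ x₄ x₅ ξ₁ x₂ c₁ d₁ d₂
    obtain ⟨η₂, ⟨i₂, j₂⟩, z₂⟩ := rolle_D1 x₁ x₂ x₃ x₄ x₅ x₃ ξ₃ a₃ d₂' d₃
    exact fin2 η₁ η₂ (by linarith) (by linarith) z₁ z₂
  · -- < = = : x₂ = x₃ = x₄ is a triple root, f'(x₂) = 0 = f''(x₂)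
    have d₂ : (x₂ - x₂) * (x₂ - x₃) * (x₂ - x₄) * (x₂ - x₅) + (x₂ - x₁) * (x₂ - x₃) * (x₂ - x₄) * (x₂ - x₅) + (x₂ - x₁) * (x₂ - x₂) * (x₂ - x₄) * (x₂ - x₅) + (x₂ - x₁) * (x₂ - x₂) * (x₂ - x₃) * (x₂ - x₅) + (x₂ - x₁) * (x₂ - x₂) * (x₂ - x₃) * (x₂ - x₄) = 0 := by subst e₂₃; ring
    have z₂ : (x₂ - x₃) * (x₂ - x₄) * (x₂ - x₅) + (x₂ - x₂) * (x₂ - x₄) * (x₂ - x₅) + (x₂ - x₂) * (x₂ - x₃) * (x₂ - x₅) + (x₂ - x₂) * (x₂ - x₃) * (x₂ - x₄) + (x₂ - x₁) * (x₂ - x₄) * (x₂ - x₅) + (x₂ - x₁) * (x₂ - x₃) * (x₂ - x₅) + (x₂ - x₁) * (x₂ - x₃) * (x₂ - x₄) + (x₂ - x₁) * (x₂ - x₂) * (x₂ - x₅) + (x₂ - x₁) * (x₂ - x₂) * (x₂ - x₄) + (x₂ - x₁) * (x₂ - x₂) * (x₂ - x₃) = 0 := by subst e₂₃; subst e₃₄;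 ring
    obtain ⟨ξ₁, ⟨a₁, c₁⟩, d₁⟩ := rolle_f x₁ x₂ x₃ x₄ x₅ x₁ x₂ l₁₂ f₁ f₂
    obtain ⟨η₁, ⟨i₁, j₁⟩, z₁⟩ := rolle_D1 x₁ x₂ x₃ x₄ x₅ ξ₁ x₂ c₁ d₁ d₂
    exact fin2 η₁ x₂ j₁ (by linarith) z₁ z₂
  · -- = < < : x₁ = x₂ is a double root
    have d₁ : (x₂ - x₂) * (x₂ - x₃) * (x₂ - x₄) * (x₂ - x₅) + (x₂ - x₁) * (x₂ - x₃) * (x₂ - x₄) * (x₂ - x₅) + (x₂ - x₁) * (x₂ - x₂) * (x₂ - x₄) * (x₂ - x₅) + (x₂ - x₁) * (x₂ - x₂) * (x₂ - x₃) * (x₂ - x₅) + (x₂ - x₁) * (x₂ - x₂) * (x₂ - x₃) * (x₂ - x₄) = 0 := by subst e₁₂; ring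
    obtain ⟨ξ₂, ⟨a₂, c₂⟩, d₂⟩ := rolle_f x₁ x₂ x₃ x₄ x₅ x₂ x₃ l₂₃ f₂ f₃
    obtain ⟨ξ₃, ⟨a₃, c₃⟩, d₃⟩ := rolle_f x₁ x₂ x₃ x₄ x₅ x₃ x₄ l₃₄ f₃ f₄
    obtain ⟨η₁, ⟨i₁, j₁⟩, z₁⟩ := rolle_D1 x₁ x₂ x₃ x₄ x₅ x₂ ξ₂ a₂ d₁ d₂
    obtain ⟨η₂, ⟨i₂, j₂⟩, z₂⟩ := rolle_D1 x₁ x₂ x₃ x₄ x₅ ξ₂ ξ₃ (by linarith) d₂ d₃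
    exact fin2 η₁ η₂ (by linarith) (by linarith) z₁ z₂
  · -- = < = : two double roots
    have d₁ : (x₂ - x₂) * (x₂ - x₃) * (x₂ - x₄) * (x₂ - x₅) + (x₂ - x₁) * (x₂ - x₃) * (x₂ - x₄) * (x₂ - x₅) + (x₂ - x₁) * (x₂ - x₂) * (x₂ - x₄) * (x₂ - x₅) + (x₂ - x₁) * (x₂ - x₂) * (x₂ - x₃) * (x₂ - x₅) + (x₂ - x₁) * (x₂ - x₂) * (x₂ - x₃) * (x₂ - x₄) = 0 := by subst e₁₂; ring
    have d₃ : (x₃ - x₂) * (x₃ - x₃) * (x₃ - x₄) * (x₃ - x₅) + (x₃ - x₁) * (x₃ - x₃) * (x₃ - x₄) * (x₃ - x₅) + (x₃ - x₁) * (x₃ - x₂) * (x₃ - x₄) * (x₃ - x₅) + (x₃ - x₁) * (x₃ - x₂) * (x₃ - x₃) * (x₃ - x₅) + (x₃ - x₁) * (x₃ - x₂) * (x₃ - x₃) * (x₃ - x₄) = 0 := by subst e₃₄; ring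
    obtain ⟨ξ₂, ⟨a₂, c₂⟩, d₂⟩ := rolle_f x₁ x₂ x₃ x₄ x₅ x₂ x₃ l₂₃ f₂ f₃
    obtain ⟨η₁, ⟨i₁, j₁⟩, z₁⟩ := rolle_D1 x₁ x₂ x₃ x₄ x₅ x₂ ξ₂ a₂ d₁ d₂
    obtain ⟨η₂, ⟨i₂, j₂⟩, z₂⟩ := rolle_D1 x₁ x₂ x₃ x₄ x₅ ξ₂ x₃ c₂ d₂ d₃
    exact fin2 η₁ η₂ (by linarith) (by linarith) z₁ z₂
  · -- = = < : x₁ = x₂ = x₃ is a triple root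
    have d₃' : (x₃ - x₂) * (x₃ - x₃) * (x₃ - x₄) * (x₃ - x₅) + (x₃ - x₁) * (x₃ - x₃) * (x₃ - x₄) * (x₃ - x₅) + (x₃ - x₁) * (x₃ - x₂) * (x₃ - x₄) * (x₃ - x₅) + (x₃ - x₁) * (x₃ - x₂) * (x₃ - x₃) * (x₃ - x₅) + (x₃ - x₁) * (x₃ - x₂) * (x₃ - x₃) * (x₃ - x₄) = 0 := by subst e₁₂; subst e₂₃; ring
    have z₁ : (x₃ - x₃) * (x₃ - x₄) * (x₃ - x₅) + (x₃ - x₂) * (x₃ - x₄) * (x₃ - x₅) + (x₃ - x₂) * (x₃ - x₃) * (x₃ - x₅) + (x₃ - x₂) * (x₃ - x₃) * (x₃ - x₄) + (x₃ - x₁) * (x₃ - x₄) * (x₃ - x₅) + (x₃ - x₁) * (x₃ - x₃) * (x₃ - x₅) + (x₃ - x₁) * (x₃ - x₃) * (x₃ - x₄) + (x₃ - x₁) * (x₃ - x₂) * (x₃ - x₅) + (x₃ - x₁) * (x₃ - x₂) * (x₃ - x₄) + (x₃ - x₁) * (x₃ - x₂) * (x₃ - x₃) = 0 := by subst e₁₂;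 subst e₂₃; ring
    obtain ⟨ξ₃, ⟨a₃, c₃⟩, d₃⟩ := rolle_f x₁ x₂ x₃ x₄ x₅ x₃ x₄ l₃₄ f₃ f₄
    obtain ⟨η₂, ⟨i₂, j₂⟩, z₂⟩ := rolle_D1 x₁ x₂ x₃ x₄ x₅ x₃ ξ₃ a₃ d₃' d₃
    exact fin2 x₃ η₂ i₂ (by linarith) z₁ z₂
  · -- = = = : quadruple root, Z(x₁) = 0 = W(x₁)
    have z : (x₁ - x₃) * (x₁ - x₄) * (x₁ - x₅) + (x₁ - x₂) * (x₁ - x₄) * (x₁ - x₅) + (x₁ - x₂) * (x₁ - x₃) * (x₁ - x₅) + (x₁ - x₂) * (x₁ - x₃) * (x₁ - x₄) + (x₁ - x₁) * (x₁ - x₄) * (x₁ - x₅) + (x₁ - x₁) * (x₁ - x₃) * (x₁ - x₅) + (x₁ - x₁) * (x₁ - x₃) * (x₁ - x₄) + (x₁ - x₁) * (x₁ - x₂) * (x₁ - x₅) + (x₁ - x₁) * (x₁ - x₂) * (x₁ - x₄) + (x₁ - x₁) * (x₁ - x₂) * (x₁ - x₃) = 0 := by subst e₁₂; subst e₂₃;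 subst e₃₄; ring
    have wq : (x₁ - x₄) * (x₁ - x₅) + (x₁ - x₃) * (x₁ - x₅) + (x₁ - x₃) * (x₁ - x₄) + (x₁ - x₂) * (x₁ - x₅) + (x₁ - x₂) * (x₁ - x₄) + (x₁ - x₂) * (x₁ - x₃) + (x₁ - x₁) * (x₁ - x₅) + (x₁ - x₁) * (x₁ - x₄) + (x₁ - x₁) * (x₁ - x₃) + (x₁ - x₁) * (x₁ - x₂) = 0 := by subst e₁₂; subst e₂₃; subst e₃₄; ring
    rw [ZZ x₁] at z
    rw [Wx_eq_W x₁ x₂ x₃ x₄ x₅ r₁ r₂ r₃ r₄ r₅ x₁ p1 p2] at wq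
    exact double_zero r₁ r₂ r₃ r₄ r₅ x₁ (by linarith) (by linarith) (by linarith) (by linarith) z wq

/-- **FOUR-ABOVE-FOUR LEMMA** (mirror of `four_below_four` under `t ↦ −t`): equal `p₁, p₂, p₃` and `r₂, r₃, r₄, r₅ < x₂ ≤ x₃ ≤ x₄ ≤ x₅`
(`x₁`, `r₁` unrestricted) is impossible. -/
theorem four_above_four (x₁ x₂ x₃ x₄ x₅ r₁ r₂ r₃ r₄ r₅ : ℝ)
    (h₂₃ : x₂ ≤ x₃) (h₃₄ : x₃ ≤ x₄) (h₄₅ : x₄ ≤ x₅)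
    (b₂ : r₂ < x₂) (b₃ : r₃ < x₂) (b₄ : r₄ < x₂) (b₅ : r₅ < x₂)
    (p1 : x₁ + x₂ + x₃ + x₄ + x₅ = r₁ + r₂ + r₃ + r₄ + r₅) (p2 : x₁ ^ 2 + x₂ ^ 2 + x₃ ^ 2 + x₄ ^ 2 + x₅ ^ 2 = r₁ ^ 2 + r₂ ^ 2 + r₃ ^ 2 + r₄ ^ 2 + r₅ ^ 2) (p3 : x₁ ^ 3 + x₂ ^ 3 + x₃ ^ 3 + x₄ ^ 3 + x₅ ^ 3 = r₁ ^ 3 + r₂ ^ 3 + r₃ ^ 3 + r₄ ^ 3 + r₅ ^ 3) : False :=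
  four_below_four (-x₅) (-x₄) (-x₃) (-x₂) (-x₁) (-r₁) (-r₂) (-r₃) (-r₄) (-r₅)
    (by linarith) (by linarith) (by linarith) (by linarith) (by linarith) (by linarith) (by linarith)
    (by linear_combination (-1 : ℝ) * p1) (by linear_combination p2) (by linear_combination (-1 : ℝ) * p3)

end Summit.HodgeConjecture.HodgeConjecture.WeilClassTestFourBelowFour
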